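import Summits.ResolutionOfSingularities.ResolutionOfSingularities.Theorems.RisoStrataRisoCentresResolveCurveAssembly
import Summits.ResolutionOfSingularities.ResolutionOfSingularities.Theorems.RisoStrataRisoCentresResolveCurveStep
import Summits.ResolutionOfSingularities.ResolutionOfSingularities.Theorems.RisoStrataRisoCentresResolveCurveReach
import Summits.ResolutionOfSingularities.ResolutionOfSingularities.Theorems.RisoStrataRisoCentresResolvePersist
import Literature.AlgebraicGeometry.Resolution.RegularLocalRingsProofs

/-!
# Route RisoStrata — crux `RisoCentresResolve` (stmt-ResolutionOfSingularities-18546), line `Sketch`, cycle 2: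
# stub `stub_rcrHeightOneLU` (valuations with one-dimensional centre)

From the two height-one lemmas of the line, taken as hypotheses —
`hStep` (the riso step at a singular centre of a finitely generated chart `B ⊆ O` whose local
ring `risoLoc O B` has Krull dimension `≤ 1` and whose centre ideal lies in the centre of `O` is,
localised at the centre of `O`, a quadratic transform along `O`) and `hReach` (a sequence of
quadratic transforms along a non-trivial `O` starting at a one-dimensional local ring
`B_{𝔪_O ∩ B}` of a finitely generated `B` with `Frac B = K` reaches `O`, a discrete valuation
ring) — we assemble riso local uniformization along the CONSTANT TOP WORD `w ≡ N` for a
presentation `K = k(hᵢ/hⱼ)` of ANY transcendence degree and a valuation ring `O ⊇ k` whose centre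
on the given chart `B₀ = k[hᵢ/hⱼ₀] ⊆ O` has a local ring of Krull dimension `≤ 1`.

Proof (generic in the cut predicate `P`, which is only required to hold at every maximal ideal
for the letter `N`), following the landed curve assembly
(`RisoStrataRisoCentresResolveCurveAssembly.lean`):
* `O = ⊤`: stage `0` is regular (`curveAssembly_regular_top`).
* `O ≠ ⊤` (`heightOneLU_tower`): the recursive everywhere-admissible tower `T 0 = B₀`,
  `T (t+1) = (T t)[Cen/x_t]` (`rcr_exists_risoValid`); its stages are the riso stages along the
  constant word `N`.
* Dimension `≤ 1` PROPAGATES along the tower (`heightOneLU_ringKrullDim_le`): the local ring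
  `L₀ = B₀_{𝔪_O ∩ B₀}` is a one-dimensional Noetherian local domain with fraction field `K`, not a
  field (`O ≠ ⊤`), and `L₀ ⊆ risoLoc O (T t)`, so Krull–Akizuki for subrings
  (`dimensionLEOne_of_le`) bounds the dimension of every `risoLoc O (T t)` by `1`.
* At a SINGULAR stage the centre ideal lies in the centre of `O` (`heightOneLU_valuation_lt_one`):
  the centre `𝔭 = 𝔪_O ∩ T t` is a singular point of `Spec (T t)`; the regular locus is open
  (`isOpen_regularLocus_of_perfectField`), so every maximal ideal `m ⊇ 𝔭` (a specialization of
  `𝔭`) is singular too, and `P` holds at `m`; hence `Cen ⊆ ⋂ {m maximal ⊇ 𝔭} = 𝔭` by the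
  Jacobson property of the finitely generated `k`-algebra `T t` (`isJacobsonRing_of_finiteType`).
* If no stage were regular, `t ↦ risoLoc O (T t)` would be an infinite sequence of quadratic
  transforms along `O` (`hStep`), which by `hReach` reaches `O`, a discrete valuation ring —
  regular: contradiction.
-/

noncomputable section

set_option linter.dupNamespace false -- mandated namespace of this single-conjunct summit

namespace Summit.ResolutionOfSingularities.ResolutionOfSingularities.Theorems

open Summit.ResolutionOfSingularities.ResolutionOfSingularities.Theses.RisoStrata
open Literature.AlgebraicGeometry.Resolution IsLocalRing

/-! ## Generic ingredients (any cut predicate `P`) -/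

section Generic

variable {k K : Type} [Field k] [Field K] [Algebra k K]

/-- A subring `R ⊆ O ⊊ K` with `Frac R = K` is not a field: otherwise every `z = a / b ∈ K`
would lie in `O`. [folklore] -/
private theorem heightOneLU_not_isField (R : Subring K)
    (hfrac : ∀ z : K, ∃ a ∈ R, ∃ b ∈ R, b ≠ 0 ∧ z = a / b)
    (O : ValuationSubring K) (hRO : R ≤ O.toSubring) (hO : O ≠ ⊤) : ¬ IsField ↥R := by
  intro hF
  apply hO
  rw [eq_top_iff]
  intro z _
  obtain ⟨a, ha, b, hb, hb0, rfl⟩ := hfrac z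
  obtain ⟨c, hc⟩ := hF.mul_inv_cancel (a := ⟨b, hb⟩) (fun h => hb0 (congrArg Subtype.val h))
  have hbc : b * (c : K) = 1 := congrArg Subtype.val hc
  rw [div_eq_mul_inv, inv_eq_of_mul_eq_one_right hbc]
  exact O.mul_mem _ _ (hRO ha) (hRO c.2)

/-- The local ring at the centre read as `locAtCentre` or as `risoLoc` has the same Krull
dimension (`B ⊆ O`; the two subrings of `K` coincide, `risoLoc_toSubring_eq`). [folklore] -/
theorem heightOneLU_ringKrullDim_locAtCentre {O : ValuationSubring K} {B : Subalgebra k K}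
    (hBO : B.toSubring ≤ O.toSubring) :
    ringKrullDim ↥(locAtCentre B.toSubring O) = ringKrullDim ↥(risoLoc O B) := by
  have hmem : ∀ x : K, x ∈ risoLoc O B ↔ x ∈ locAtCentre B.toSubring O := fun x => by
    rw [← risoLoc_toSubring_eq hBO]; rfl
  let e : ↥(risoLoc O B) ≃+* ↥(locAtCentre B.toSubring O) :=
    { toFun := fun x => ⟨x.1, (hmem x.1).mp x.2⟩
      invFun := fun x => ⟨x.1, (hmem x.1).mpr x.2⟩
      left_inv := fun _ => rfl
      right_inv := fun _ => rfl
      map_mul' := fun _ _ => rfl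
      map_add' := fun _ _ => rfl }
  exact (ringKrullDim_eq_of_ringEquiv e).symm

/-- **Dimension `≤ 1` propagates along the tower (Krull–Akizuki).** Let `B₀ ⊆ O ⊊ K` be finitely
generated with `Frac B₀ = K` and `dim B₀_{𝔪_O ∩ B₀} ≤ 1`. Then for every `B ⊇ B₀` the ring
`risoLoc O B ⊇ B₀_{𝔪_O ∩ B₀}` has Krull dimension `≤ 1`: it contains the one-dimensional
Noetherian local domain `B₀_{𝔪_O ∩ B₀}` (not a field, as `O ≠ K`) with the same fraction field.
[folklore] -/
theorem heightOneLU_ringKrullDim_le {O : ValuationSubring K} {B₀ B : Subalgebra k K}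
    (hB₀ : B₀.FG) (hfrac : ∀ z : K, ∃ a ∈ B₀, ∃ b ∈ B₀, b ≠ 0 ∧ z = a / b)
    (hB₀O : B₀.toSubring ≤ O.toSubring) (hO : O ≠ ⊤)
    (hdim : ringKrullDim ↥(risoLoc O B₀) ≤ 1) (hle : B₀ ≤ B) :
    ringKrullDim ↥(risoLoc O B) ≤ 1 := by
  haveI := isLocalization_locAtCentre hB₀O
  haveI : IsNoetherianRing ↥(locAtCentre B₀.toSubring O) :=
    IsLocalization.isNoetherianRing (subringCentre B₀.toSubring O hB₀O).primeCompl _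
      (show IsNoetherianRing ↥B₀.toSubring from isNoetherianRing_of_fg hB₀)
  haveI : Ring.KrullDimLE 1 ↥(locAtCentre B₀.toSubring O) :=
    Ring.krullDimLE_iff.mpr (by rw [heightOneLU_ringKrullDim_locAtCentre hB₀O]; exact hdim)
  have hof : IsLocalRingOf (locAtCentre B₀.toSubring O) := by
    refine ⟨isLocalRing_locAtCentre hB₀O, fun z => ?_⟩
    obtain ⟨a, ha, b, hb, hb0, rfl⟩ := hfrac z
    exact ⟨a, le_locAtCentre _ O ha, b, le_locAtCentre _ O hb, hb0, rfl⟩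
  have hnf : ¬ IsField ↥(locAtCentre B₀.toSubring O) :=
    heightOneLU_not_isField _ hof.2 O (locAtCentre_le hB₀O) hO
  have hle' : locAtCentre B₀.toSubring O ≤ (risoLoc O B).toSubring := by
    rw [← risoLoc_toSubring_eq hB₀O]
    exact fun y hy => risoLoc_mono O hle hy
  haveI : Ring.DimensionLEOne ↥(risoLoc O B).toSubring := dimensionLEOne_of_le hof hnf hle'
  have h1 : ringKrullDim ↥(risoLoc O B).toSubring ≤ 1 := Ring.krullDimLE_iff.mp inferInstance
  let e : ↥(risoLoc O B) ≃+* ↥(risoLoc O B).toSubring :=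
    { toFun := fun x => ⟨x.1, x.2⟩
      invFun := fun x => ⟨x.1, x.2⟩
      left_inv := fun _ => rfl
      right_inv := fun _ => rfl
      map_mul' := fun _ _ => rfl
      map_add' := fun _ _ => rfl }
  rwa [ringKrullDim_eq_of_ringEquiv e]

/-- **At a singular centre the centre ideal lies in the centre of `O`.** Let `B ⊆ O` be a
finitely generated `k`-subalgebra (`k` algebraically closed) whose local ring at the centre
`𝔭 = 𝔪_O ∩ B` of `O` is NOT regular, and let `P` hold at every maximal ideal for the letter `d`.
Every maximal ideal `m ⊇ 𝔭` is a specialization of the singular point `𝔭`, hence singular (the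
regular locus is open, `isOpen_regularLocus_of_perfectField`), so `m` is one of the ideals cut
out by `risoCen P B d`; and `𝔭 = ⋂ {m maximal ⊇ 𝔭}` since `B` is a Jacobson ring
(`isJacobsonRing_of_finiteType`). Hence `risoCen P B d ⊆ 𝔭`, i.e. `ν > 0` on it. [folklore] -/
theorem heightOneLU_valuation_lt_one [IsAlgClosed k]
    (P : ∀ B : Subalgebra k K, Ideal ↥B → ℕ → Prop) {O : ValuationSubring K}
    {B : Subalgebra k K} (hB : B.FG) (hBO : B.toSubring ≤ O.toSubring) (d : ℕ)
    (hP : ∀ m : Ideal ↥B, m.IsMaximal → P B m d)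
    (hsing : ¬ IsRegularLocalRing ↥(risoLoc O B)) :
    ∀ a ∈ risoCen P B d, O.valuation ((a : ↥B) : K) < 1 := by
  haveI : Algebra.FiniteType k ↥B := (Subalgebra.fg_iff_finiteType B).mp hB
  have hJac : IsJacobsonRing ↥B := isJacobsonRing_of_finiteType (A := k) (B := ↥B)
  intro a ha
  -- the centre `𝔪_O ∩ B` as a (singular) point of `Spec B`
  let p : PrimeSpectrum ↥B :=
    ⟨subringCentre B.toSubring O hBO, subringCentre.isPrime B.toSubring O hBO⟩
  have hp : p ∉ regularLocus ↥B := fun hreg =>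
    hsing ((isRegularLocalRing_risoLoc_iff hBO).mpr ((mem_regularLocus p).mp hreg))
  suffices h : a ∈ p.asIdeal from (mem_subringCentre_iff hBO a).mp h
  have hJ : p.asIdeal.jacobson = p.asIdeal := hJac.out p.isPrime.isRadical
  rw [← hJ, Ideal.jacobson, Ideal.mem_sInf]
  rintro m ⟨hpm, hm⟩
  -- `m ⊇ 𝔭` is singular
  have hmsing : ¬ IsRegularLocalRing (Localization.AtPrime m) := by
    intro hreg
    have hspec : p ⤳ (⟨m, hm.isPrime⟩ : PrimeSpectrum ↥B) :=
      (PrimeSpectrum.le_iff_specializes _ _).mp hpm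
    exact hp (hspec.mem_open (isOpen_regularLocus_of_perfectField k ↥B)
      ((mem_regularLocus _).mpr hreg))
  simp only [risoCen, Submodule.mem_iInf, Set.mem_setOf_eq] at ha
  exact ha m ⟨hm, hmsing, hP m hm⟩

/-- **The everywhere-admissible tower along a non-trivial valuation ring with one-dimensional
centre reaches a regular local ring** (cut predicate `P` holding at every maximal ideal for the
letter `N`). Choose an admissible denominator for every finitely generated chart inside `O` and
iterate the riso step from `B₀`; the stages along the constant word `N` are these iterates, their
local rings at the centre of `O` have dimension `≤ 1` (`heightOneLU_ringKrullDim_le`) and, while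
singular, centre ideals inside the centre of `O` (`heightOneLU_valuation_lt_one`). If none of them
were regular, these local rings would form an infinite sequence of quadratic transforms along `O`
(`hStep`), which by `hReach` reaches the discrete valuation ring `O` — a regular local ring:
contradiction. [folklore] -/
theorem heightOneLU_tower [IsAlgClosed k]
    (hStep : ∀ (P : ∀ B : Subalgebra k K, Ideal ↥B → ℕ → Prop) (d : ℕ)
      (B : Subalgebra k K), B.FG → ∀ (O : ValuationSubring K), B.toSubring ≤ O.toSubring →
      ringKrullDim ↥(risoLoc O B) ≤ 1 → ¬ IsRegularLocalRing ↥(risoLoc O B) →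
      (∀ a ∈ risoCen P B d, O.valuation ((a : ↥B) : K) < 1) → ∀ xt : K, risoValid P O B d xt →
      IsQuadraticTransformAlong O (risoLoc O B).toSubring
        (risoLoc O (risoStep P B d xt)).toSubring)
    (hReach : ∀ (B : Subalgebra k K), B.FG →
      (∀ z : K, ∃ a ∈ B, ∃ b ∈ B, b ≠ 0 ∧ z = a / b) →
      ∀ (O : ValuationSubring K), B.toSubring ≤ O.toSubring → O ≠ ⊤ →
      ringKrullDim ↥(locAtCentre B.toSubring O) ≤ 1 →
      ∀ A : ℕ → Subring K, A 0 = locAtCentre B.toSubring O →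
      (∀ i, IsQuadraticTransformAlong O (A i) (A (i + 1))) →
      IsDiscreteValuationRing ↥O ∧ ∃ c, A c = O.toSubring)
    (P : ∀ B : Subalgebra k K, Ideal ↥B → ℕ → Prop) (N : ℕ)
    (hP : ∀ (B : Subalgebra k K) (m : Ideal ↥B), m.IsMaximal → P B m N)
    (B₀ : Subalgebra k K) (hB₀ : B₀.FG)
    (hfrac : ∀ z : K, ∃ a ∈ B₀, ∃ b ∈ B₀, b ≠ 0 ∧ z = a / b)
    (O : ValuationSubring K) (hB₀O : B₀.toSubring ≤ O.toSubring) (hO : O ≠ ⊤)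
    (hdim : ringKrullDim ↥(risoLoc O B₀) ≤ 1) :
    ∃ (x : ℕ → K) (t : ℕ),
      (∀ s, s < t →
        risoValid P O (risoStage P B₀ ((List.range t).map fun _ => N) x s) N (x s)) ∧
      IsRegularLocalRing
        ↥(risoLoc O (risoStage P B₀ ((List.range t).map fun _ => N) x t)) := by
  classical
  -- an admissible denominator for every finitely generated chart inside `O`
  have hsel : ∀ B : Subalgebra k K, ∃ xt : K,
      B.FG → B.toSubring ≤ O.toSubring → risoValid P O B N xt := by
    intro B
    by_cases hB : B.FG ∧ B.toSubring ≤ O.toSubring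
    · obtain ⟨xt, hxt⟩ := rcr_exists_risoValid P O B hB.1 hB.2 N
      exact ⟨xt, fun _ _ => hxt⟩
    · exact ⟨0, fun h1 h2 => absurd ⟨h1, h2⟩ hB⟩
  choose xsel hxsel using hsel
  -- the recursive tower `T 0 = B₀`, `T (t+1) = (T t)[Cen/xsel (T t)]`
  obtain ⟨T, hT0, hTs⟩ : ∃ T : ℕ → Subalgebra k K,
      T 0 = B₀ ∧ ∀ t, T (t + 1) = risoStep P (T t) N (xsel (T t)) :=
    ⟨fun t => Nat.rec (motive := fun _ => Subalgebra k K) B₀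
      (fun _ B => risoStep P B N (xsel B)) t, rfl, fun _ => rfl⟩
  have hinv : ∀ t, (T t).FG ∧ (T t).toSubring ≤ O.toSubring := by
    intro t
    induction t with
    | zero => rw [hT0]; exact ⟨hB₀, hB₀O⟩
    | succ t ih =>
      rw [hTs t]
      exact ⟨risoStep_fg ih.1 _ _, risoStep_toSubring_le ih.2 (hxsel _ ih.1 ih.2)⟩
  have hle0 : ∀ t, B₀ ≤ T t := by
    intro t
    induction t with
    | zero => rw [hT0]
    | succ t ih => rw [hTs t]; exact ih.trans (le_risoStep P _ _ _)
  obtain ⟨x, hx⟩ : ∃ x : ℕ → K, ∀ t, x t = xsel (T t) := ⟨_, fun _ => rfl⟩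
  have hval : ∀ t, risoValid P O (T t) N (x t) := fun t => by
    rw [hx]; exact hxsel (T t) (hinv t).1 (hinv t).2
  -- the stages along the constant word `N` with denominators `x` are the `T s`
  have hstage : ∀ t s, s ≤ t →
      risoStage P B₀ ((List.range t).map fun _ => N) x s = T s := by
    intro t s
    induction s with
    | zero => intro; rw [risoStage_zero, hT0]
    | succ s ih =>
      intro hs
      have hs' : s < ((List.range t).map fun _ => N).length := by
        rw [List.length_map, List.length_range]; exact hs
      have hget : ((List.range t).map fun _ => N).getD s 0 = N := by
        rw [reduction_getD_map_range (fun _ => N) (show s < t from hs)]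
      rw [risoStage_succ P B₀ _ x hs', ih (Nat.le_of_succ_le hs), hget, hTs s, hx s]
  -- some `T t` has a regular local ring at the centre of `O`
  have hex : ∃ t, IsRegularLocalRing ↥(risoLoc O (T t)) := by
    by_contra hall
    push Not at hall
    obtain ⟨A, hA⟩ : ∃ A : ℕ → Subring K, ∀ t, A t = (risoLoc O (T t)).toSubring :=
      ⟨_, fun _ => rfl⟩
    have hA0 : A 0 = locAtCentre B₀.toSubring O := by
      rw [hA, hT0]; exact risoLoc_toSubring_eq hB₀O
    have hAstep : ∀ i, IsQuadraticTransformAlong O (A i) (A (i + 1)) := fun i => by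
      rw [hA, hA, hTs i, ← hx i]
      exact hStep P N (T i) (hinv i).1 O (hinv i).2
        (heightOneLU_ringKrullDim_le hB₀ hfrac hB₀O hO hdim (hle0 i)) (hall i)
        (heightOneLU_valuation_lt_one P (hinv i).1 (hinv i).2 N (hP (T i)) (hall i))
        (x i) (hval i)
    have hdim' : ringKrullDim ↥(locAtCentre B₀.toSubring O) ≤ 1 := by
      rw [heightOneLU_ringKrullDim_locAtCentre hB₀O]; exact hdim
    obtain ⟨hdvr, c, hc⟩ := hReach B₀ hB₀ hfrac O hB₀O hO hdim' A hA0 hAstep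
    rw [hA] at hc
    haveI : IsDiscreteValuationRing ↥O := hdvr
    have hmemc : ∀ y : K, y ∈ risoLoc O (T c) ↔ y ∈ O := fun y => SetLike.ext_iff.mp hc y
    let e : ↥(risoLoc O (T c)) ≃+* ↥O :=
      { toFun := fun y => ⟨y.1, (hmemc y.1).mp y.2⟩
        invFun := fun y => ⟨y.1, (hmemc y.1).mpr y.2⟩
        left_inv := fun _ => rfl
        right_inv := fun _ => rfl
        map_mul' := fun _ _ => rfl
        map_add' := fun _ _ => rfl }
    exact hall c (IsRegularLocalRing.of_ringEquiv e.symm)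
  obtain ⟨t, ht⟩ := hex
  refine ⟨x, t, fun s hs => ?_, ?_⟩
  · rw [hstage t s hs.le]; exact hval s
  · rw [hstage t t le_rfl]; exact ht

end Generic

/-! ## The stub -/

/-- **Stub (height-one local uniformization along the top word, every dimension).** For a cut
predicate `P` holding at every maximal ideal at level `N` (the top letter), a projective presentation
`K = k(hᵢ/hⱼ)` by `N + 1` nonzero elements (of ANY transcendence degree) and a valuation ring `O ⊇ k`
some chart of which lies in `O` with a local ring at the centre of Krull dimension `≤ 1` (the centre
of `O` is the generic point or a point of codimension one — e.g. a branch through the generic point of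
a singular curve), some admissible chart path of the constant top word reaches a regular local ring at
the centre of `O` after finitely many steps. -/
theorem stub_rcrHeightOneLU
    (hStep : ∀ {k K : Type} [Field k] [IsAlgClosed k] [Field K] [Algebra k K]
      (P : ∀ B : Subalgebra k K, Ideal ↥B → ℕ → Prop) (d : ℕ)
      (B : Subalgebra k K), B.FG → ∀ (O : ValuationSubring K), B.toSubring ≤ O.toSubring →
      ringKrullDim ↥(risoLoc O B) ≤ 1 → ¬ IsRegularLocalRing ↥(risoLoc O B) →
      (∀ a ∈ risoCen P B d, O.valuation ((a : ↥B) : K) < 1) → ∀ xt : K, risoValid P O B d xt →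
      IsQuadraticTransformAlong O (risoLoc O B).toSubring
        (risoLoc O (risoStep P B d xt)).toSubring)
    (hReach : ∀ {k K : Type} [Field k] [Field K] [Algebra k K] (B : Subalgebra k K), B.FG →
      (∀ z : K, ∃ a ∈ B, ∃ b ∈ B, b ≠ 0 ∧ z = a / b) →
      ∀ (O : ValuationSubring K), B.toSubring ≤ O.toSubring → O ≠ ⊤ →
      ringKrullDim ↥(locAtCentre B.toSubring O) ≤ 1 →
      ∀ A : ℕ → Subring K, A 0 = locAtCentre B.toSubring O →
      (∀ i, IsQuadraticTransformAlong O (A i) (A (i + 1))) →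
      IsDiscreteValuationRing ↥O ∧ ∃ c, A c = O.toSubring)
    {k K : Type} [Field k] [IsAlgClosed k] [Field K] [Algebra k K]
    (P : ∀ B : Subalgebra k K, Ideal ↥B → ℕ → Prop) (N : ℕ)
    (hP : ∀ (B : Subalgebra k K) (m : Ideal ↥B), m.IsMaximal → P B m N)
    (h : Fin (N + 1) → K) (hh : ∀ i, h i ≠ 0)
    (hgen : IntermediateField.adjoin k
      (Set.range fun ij : Fin (N + 1) × Fin (N + 1) => h ij.1 * (h ij.2)⁻¹) = ⊤)
    (O : ValuationSubring K) (hk : ∀ c : k, algebraMap k K c ∈ O)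
    (j₀ : Fin (N + 1)) (hj₀ : ∀ i, h i * (h j₀)⁻¹ ∈ O)
    (hdim : ringKrullDim ↥(risoLoc O (Algebra.adjoin k (Set.range fun i => h i * (h j₀)⁻¹))) ≤ 1) :
    ∃ (j : Fin (N + 1)) (x : ℕ → K) (t : ℕ), (∀ i, h i * (h j)⁻¹ ∈ O) ∧
      (∀ s, s < t → risoValid P O (risoStage P (Algebra.adjoin k (Set.range fun i => h i * (h j)⁻¹))
        ((List.range t).map fun _ => N) x s) N (x s)) ∧
      IsRegularLocalRing ↥(risoLoc O (risoStage P
        (Algebra.adjoin k (Set.range fun i => h i * (h j)⁻¹)) ((List.range t).map fun _ => N) x t)) := by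
  have hB₀O := chart_toSubring_le hk h j₀ hj₀
  by_cases hO : O = ⊤
  · subst hO
    exact ⟨j₀, fun _ => 0, 0, hj₀, fun s hs => absurd hs (Nat.not_lt_zero s),
      curveAssembly_regular_top _⟩
  · obtain ⟨x, t, hV, hreg⟩ := heightOneLU_tower hStep hReach P N hP _
      (curveAssembly_chart_fg h j₀) (curveAssembly_frac h hh hgen j₀) O hB₀O hO hdim
    exact ⟨j₀, x, t, hj₀, hV, hreg⟩

end Summit.ResolutionOfSingularities.ResolutionOfSingularities.Theorems

end
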